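import Literature.AlgebraicGeometry.Motives.FrobeniusSemisimpleDominatedByAbelianVarieties
import Literature.AlgebraicGeometry.Motives.ZetaFunctionPoleOrderFrobeniusSemisimple
import HarnessLib

/-!
# Degrees in which every class is algebraic: the Galois action is the character `χ^{-r}`, and the
# conjectures `T^r`, `E^r`, `S^r`, `SS^{2r}` hold (Milne 2007 §1; Tate 1994 §1–§2; Kahn 2020 §6.14)

Topic `Literature/AlgebraicGeometry/Motives`; THEOREMS ONLY (no definition, no instance, no named
fact; D-0026).

J. S. Milne, arXiv:0709.3040 §1 (held, p. 3): «Conjecture `T^r(X, ℓ)` (Tate). The `ℚ_ℓ`-vector space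
`H^{2r}(X, ℚ_ℓ(r))′` is spanned by algebraic classes.» … «Conjecture `E^r(X, ℓ)` … The kernel of the
cycle class map … consists exactly of the cycles numerically equivalent to zero.» … «Conjecture
`S^r(X, ℓ)` … Every Frobenius map `π` of `X` acts semisimply on `H^{2r}(X, ℚ_ℓ(r))_1` (i.e., it acts
as `1`).»  B. Kahn (2020) §6.14 p. 132: `T^i`, `S^i`, `SS^i`, Th. 6.53.  When the algebraic classes
span ALL of `H^{2r}(X)` — `K·Aʳ(X) = H^{2r}(X)` (cellular varieties, supersingular abelian varieties
(Lenstra–Zarhin, the tree's `SupersingularAbelianVariety`), the extreme degrees `r = 0`, `r = dim X`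
of gen-37 `TateConjectureExtremeCodimensions`) — every one of these statements holds for trivial
reasons, because algebraic classes are fixed by the twisted Galois action (`algebraicClasses_le_invariants`).
This file records the general-`r` form (gen 37 did `r = 0, dim X`):

* §1 any field `k`, any `g ∈ Γ_k`: `χ(g)ʳ ρ(g) = 1` on `H^{2r}(X)` (`ρTwist_eq_one_of_algebraicClasses_eq_top`),
  `ρ(g) = χ(g)^{-r} · 1` (`ρ_eq_smul_one_of_algebraicClasses_eq_top`), `ρ(g)` semisimple, **`T^r`**
  (`tateConjectureFor_of_algebraicClasses_eq_top`: algebraic = invariants), invariants = Tate classes = all.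
* §2 `k` finite: `S^r` (`ker_inf_range_eq_bot_of_algebraicClasses_eq_top`), the generalized
  eigenspace `H^{2r}(X)(r)_1` is everything and `dim K·Aʳ(X) = dim H^{2r}(X)(r)_1` (Milne 1986's
  `T(X, r)`), **`E^r`** when also `K·Aˢ(X) = H^{2s}(X)`, `r + s = d` (gen-37
  `homNum_of_algebraicClasses_eq_top_right`), hence Tate's (a) = `T ∧ E` and all its consequences
  (`tate_a_of_algebraicClasses_eq_top`, `consequences_…`), and the pole order
  `ord_{t=q^{-r}} Z(X, t) = dim_K H^{2r}(X)` (`hasPoleOfOrderAt_zetaSeries_finrank_of_…`).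
* §3 VARIETIES WITH ALGEBRAIC EVEN COHOMOLOGY AND NO ODD COHOMOLOGY (`K·Aʳ = H^{2r}` for all `r`,
  `H^{2r+1} = 0`): every `g ∈ Γ_k` acts semisimply on all of `H^*(X)` (`forall_isSemisimple_ρ_of_algebraic_cohomology`),
  hence (finite `k`) `S` for every twisted Frobenius on `H^*(X)` and `H^*(X × X)` and the strong
  Tate condition `S^d(X × X)` of Th. 6.54; `T^r` and `E^r` for all `r`; `D(X)` is the tree's
  `standardConjectureD_of_algebraicClasses_eq_top`.

## Provenance

Lane `lit-hodgefound` (summit `HodgeConjecture`, Track 2 foundations library, Layer B: motives),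
seat `lit-hodgefound-p29` (literature-prover, generation 38, row g38-#10).
-/

universe u v

open CategoryTheory AlgebraicGeometry MonoidalCategory CartesianMonoidalCategory
open Literature.AlgebraicGeometry.Kahn2003 (HasPoleOfOrderAt)

noncomputable section

/-! ## §0 (pure) Endomorphisms of the zero space -/

namespace Literature.LinearAlgebra

/-- Every endomorphism of the zero module is semisimple (its only invariant submodule `⊥ = ⊤` is
complemented). [cite: HoffmanKunze1971LinearAlgebra, §7.5 Definition (chunk p0221 L3)] -/
theorem isSemisimple_of_subsingleton {R : Type*} [CommRing R] {M : Type*} [AddCommGroup M]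
    [Module R M] [Subsingleton M] (f : Module.End R M) : f.IsSemisimple := by
  refine Module.End.isSemisimple_iff.mpr fun p _ ↦ ⟨⊤, ?_, ?_⟩
  · exact (Module.End.mem_invtSubmodule _).mpr le_top
  · rw [Subsingleton.elim p ⊥]
    exact isCompl_bot_top

/-- A scalar operator `c · 1` on a vector space is semisimple.
[cite: HoffmanKunze1971LinearAlgebra, §7.5 Definition (chunk p0221 L3)] -/
theorem isSemisimple_smul_one {K : Type*} [Field K] {V : Type*} [AddCommGroup V] [Module K V]
    (c : K) : Module.End.IsSemisimple (c • (1 : Module.End K V)) := by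
  refine Module.End.IsSemisimple_smul c (Module.End.isSemisimple_iff.mpr fun p _ ↦ ?_)
  obtain ⟨q, hq⟩ := p.exists_isCompl
  exact ⟨q, (Module.End.mem_invtSubmodule _).mpr fun x hx ↦ by simpa using hx, hq⟩

end Literature.LinearAlgebra

namespace Literature.AlgebraicGeometry.Motives

open Literature.LinearAlgebra

namespace GaloisWeilCohomology

variable {k : Type u} [Field k] {K : Type v} [Field K] [CharZero K]
  {χ : Field.absoluteGaloisGroup k →* Kˣ} (E : GaloisWeilCohomology k K χ)
variable {d : ℕ} {X : SchemeOver k}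

/-! ## §1 Any field: the twisted action is trivial on an algebraic `H^{2r}(X)` -/

/-- **If `K·Aʳ(X) = H^{2r}(X)` then `χ(g)ʳ ρ(g) = 1` on `H^{2r}(X)`** (algebraic classes are invariant
under the twisted action). [cite: Tate1994, §1] [cite: Milne2007TateFiniteFieldsAIM, §1 Conjecture T^r(X, ℓ)] -/
theorem ρTwist_eq_one_of_algebraicClasses_eq_top (hX : IsSmoothProjective d X) {r : ℕ}
    (h : E.algebraicClasses X r = ⊤) (g : Field.absoluteGaloisGroup k) :
    E.ρTwist X (2 * r) r g = 1 := by
  refine LinearMap.ext fun x ↦ ?_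
  have hx : x ∈ E.algebraicClasses X r := h ▸ Submodule.mem_top
  exact E.algebraicClasses_le_invariants hX r hx g

/-- **`ρ(g) = χ(g)^{-r} · 1` on an algebraic `H^{2r}(X)`.** [cite: Tate1994, §1] -/
theorem ρ_eq_smul_one_of_algebraicClasses_eq_top (hX : IsSmoothProjective d X) {r : ℕ}
    (h : E.algebraicClasses X r = ⊤) (g : Field.absoluteGaloisGroup k) :
    E.ρ X (2 * r) g = ((χ g : K) ^ (r : ℤ))⁻¹ • (1 : Module.End K (E.obj X (2 * r))) := by
  refine LinearMap.ext fun x ↦ ?_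
  have hx := congrArg (fun T ↦ T x) (E.ρTwist_eq_one_of_algebraicClasses_eq_top hX h g)
  simp only [ρTwist_apply, Module.End.one_apply] at hx
  rw [LinearMap.smul_apply, Module.End.one_apply]
  conv_rhs => rw [← hx]
  rw [smul_smul, inv_mul_cancel₀ (zpow_ne_zero _ (χ g).ne_zero), one_smul]

/-- `ρ(g)` is semisimple on an algebraic `H^{2r}(X)` (a scalar). [cite: Kahn2020, §6.14 SS^i(X, l)] -/
theorem isSemisimple_ρ_of_algebraicClasses_eq_top (hX : IsSmoothProjective d X) {r : ℕ}
    (h : E.algebraicClasses X r = ⊤) (g : Field.absoluteGaloisGroup k) :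
    Module.End.IsSemisimple (E.ρ X (2 * r) g) := by
  rw [E.ρ_eq_smul_one_of_algebraicClasses_eq_top hX h g]
  exact isSemisimple_smul_one _

/-- **`T^r(X)` holds trivially when `K·Aʳ(X) = H^{2r}(X)`**: the algebraic classes are then exactly
the invariants of the twisted action. [cite: Milne2007TateFiniteFieldsAIM, §1 Conjecture T^r(X, ℓ)]
[cite: Tate1994, §1 Conjecture Tᵖ] -/
theorem tateConjectureFor_of_algebraicClasses_eq_top (hX : IsSmoothProjective d X) {r : ℕ}
    (h : E.algebraicClasses X r = ⊤) : E.TateConjectureFor X r :=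
  le_antisymm (E.algebraicClasses_le_invariants hX r) (h ▸ le_top)

/-- When `K·Aʳ(X) = H^{2r}(X)` the invariants and the Tate classes of `H^{2r}(X)(r)` are everything.
[cite: Tate1994, §1] -/
theorem invariants_eq_top_of_algebraicClasses_eq_top (hX : IsSmoothProjective d X) {r : ℕ}
    (h : E.algebraicClasses X r = ⊤) :
    (E.ρTwist X (2 * r) r).invariants = ⊤ ∧ E.tateClasses X r = ⊤ := by
  have h1 : (E.ρTwist X (2 * r) r).invariants = ⊤ :=
    eq_top_iff.mpr (h ▸ E.algebraicClasses_le_invariants hX r)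
  exact ⟨h1, eq_top_iff.mpr (h1 ▸ E.invariants_le_tateClasses X r)⟩

/-! ## §2 Finite field: `S^r`, multiplicities, `E^r`, Tate's (a) and the pole order -/

section Frobenius

variable [Finite k]

/-- **`S^r(X)` holds when `K·Aʳ(X) = H^{2r}(X)`**: `φ_r = χ(F)ʳ F = 1`, so `Ker(φ_r − 1) = H` and
`(φ_r − 1)H = 0`. [cite: Milne2007TateFiniteFieldsAIM, §1 Conjecture S^r(X, ℓ)] [cite: Kahn2020, §6.14 S^i(X, l)] -/
theorem ker_inf_range_eq_bot_of_algebraicClasses_eq_top (hX : IsSmoothProjective d X) {r : ℕ}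
    (h : E.algebraicClasses X r = ⊤) :
    LinearMap.ker (E.ρTwist X (2 * r) r (geomFrob k) - 1) ⊓
      LinearMap.range (E.ρTwist X (2 * r) r (geomFrob k) - 1) = ⊥ := by
  rw [E.ρTwist_eq_one_of_algebraicClasses_eq_top hX h, sub_self, LinearMap.range_zero, inf_bot_eq]

/-- With `K·Aʳ(X) = H^{2r}(X)`: `Ker(φ_r − 1) = H^{2r}(X)` and `K·Aʳ(X) = Ker(φ_r − 1)` (Milne's `T′`).
[cite: Milne1986ValuesZetaFunctionsFiniteFields, §8 p. 345 T′(X, r)] -/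
theorem algebraicClasses_eq_ker_of_algebraicClasses_eq_top (hX : IsSmoothProjective d X) {r : ℕ}
    (h : E.algebraicClasses X r = ⊤) :
    LinearMap.ker (E.ρTwist X (2 * r) r (geomFrob k) - 1) = ⊤ ∧
      E.algebraicClasses X r = LinearMap.ker (E.ρTwist X (2 * r) r (geomFrob k) - 1) := by
  have hk : LinearMap.ker (E.ρTwist X (2 * r) r (geomFrob k) - 1) = ⊤ := by
    rw [E.ρTwist_eq_one_of_algebraicClasses_eq_top hX h, sub_self, LinearMap.ker_zero]
  exact ⟨hk, h.trans hk.symm⟩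

/-- With `K·Aʳ(X) = H^{2r}(X)`: `dim K·Aʳ(X) = dim H^{2r}(X)(r)_1 = dim H^{2r}(X)` (Milne 1986's
`T(X, r)`: the dimension of the algebraic classes is the multiplicity of `q^r` as an inverse root of
`P_{2r}`, here the whole Betti number). [cite: Milne1986ValuesZetaFunctionsFiniteFields, §8 Prop. 8.2] -/
theorem finrank_algebraicClasses_eq_of_algebraicClasses_eq_top (hX : IsSmoothProjective d X) {r : ℕ}
    (h : E.algebraicClasses X r = ⊤) :
    Module.finrank K (E.algebraicClasses X r) =
        Module.finrank K (Module.End.maxGenEigenspace (E.ρTwist X (2 * r) r (geomFrob k)) 1) ∧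
      Module.finrank K (Module.End.maxGenEigenspace (E.ρTwist X (2 * r) r (geomFrob k)) 1) =
        Module.finrank K (E.obj X (2 * r)) := by
  obtain ⟨hk, hT⟩ := E.algebraicClasses_eq_ker_of_algebraicClasses_eq_top hX h
  have hmax : Module.End.maxGenEigenspace (E.ρTwist X (2 * r) r (geomFrob k)) 1 = ⊤ :=
    eq_top_iff.mpr (hk ▸ (InvariantPairing.ker_inf_range_eq_bot_iff_maxGenEigenspace_eq _).mp
      (E.ker_inf_range_eq_bot_of_algebraicClasses_eq_top hX h)).ge
  rw [h, hmax, finrank_top]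
  exact ⟨rfl, rfl⟩

/-- **Tate's (a) `T ∧ E` in codimension `r` when `K·Aʳ = H^{2r}` and `K·Aˢ = H^{2s}`, `r + s = d`**
(`E^r` from Poincaré duality, gen-37 `homNum_of_algebraicClasses_eq_top_right`).
[cite: Tate1994, §2 Th. 2.9] [cite: Milne2007TateFiniteFieldsAIM, §1 Conjectures T^r, E^r] -/
theorem tate_a_of_algebraicClasses_eq_top (hX : IsSmoothProjective d X) {r s : ℕ}
    (h2 : 2 * r + 2 * s = 2 * d) (hr : E.algebraicClasses X r = ⊤)
    (hs : E.algebraicClasses X s = ⊤) :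
    E.algebraicClasses X r = LinearMap.ker (E.ρTwist X (2 * r) r (geomFrob k) - 1) ∧
      ∀ x ∈ E.ratAlgebraicClasses X r, (∀ y ∈ E.ratAlgebraicClasses X s,
        E.cupPairing X d (2 * r) (2 * s) h2 x y = 0) → x = 0 :=
  ⟨(E.algebraicClasses_eq_ker_of_algebraicClasses_eq_top hX hr).2,
    E.homNum_of_algebraicClasses_eq_top_right hX h2 hs⟩

/-- **All of Tate's equivalent statements in codimensions `r`, `s`** (`T^r`, `T^s`, `E^r`, `E^s`,
`S^r`, `S^s`) when `K·Aʳ = H^{2r}` and `K·Aˢ = H^{2s}`, `r + s = d`.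
[cite: Tate1994, §2 Th. 2.9] [cite: Kahn2020, §6.14 Th. 6.53] -/
theorem consequences_of_algebraicClasses_eq_top (hX : IsSmoothProjective d X) {r s : ℕ}
    (hrs : r + s = d) (h2 : 2 * r + 2 * s = 2 * d) (h2' : 2 * s + 2 * r = 2 * d)
    (hr : E.algebraicClasses X r = ⊤) (hs : E.algebraicClasses X s = ⊤) :
    E.TateConjectureFor X r ∧ E.TateConjectureFor X s ∧
      (∀ y ∈ E.ratAlgebraicClasses X s, (∀ x ∈ E.ratAlgebraicClasses X r,
        E.cupPairing X d (2 * s) (2 * r) h2' y x = 0) → y = 0) ∧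
      LinearMap.ker (E.ρTwist X (2 * r) r (geomFrob k) - 1) ⊓
          LinearMap.range (E.ρTwist X (2 * r) r (geomFrob k) - 1) = ⊥ ∧
      LinearMap.ker (E.ρTwist X (2 * s) s (geomFrob k) - 1) ⊓
          LinearMap.range (E.ρTwist X (2 * s) s (geomFrob k) - 1) = ⊥ :=
  have ha := E.tate_a_of_algebraicClasses_eq_top hX h2 hr hs
  E.consequences_of_tate_a hX hrs h2 h2' ha.1 ha.2

/-- **`ord_{t=q^{-r}} Z(X, t) = dim_K H^{2r}(X)`** (the whole Betti number) when `K·Aʳ(X) = H^{2r}(X)`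
(trace formula, `χ(φ) = q`, RH). [cite: Tate1994, §2 Th. 2.9] [cite: Milne2007TateFiniteFieldsAIM, Th. 1.2] -/
theorem hasPoleOfOrderAt_zetaSeries_finrank_of_algebraicClasses_eq_top
    (hE : E.HasLefschetzTraceFormula) (hχ : ((χ (arithFrob k) : Kˣ) : K) = Nat.card k)
    (hX : IsSmoothProjective d X) (hRH : E.WeilRiemannHypothesisFor X d) {r : ℕ} (hr : r ≤ d)
    (h : E.algebraicClasses X r = ⊤) :
    HasPoleOfOrderAt (zetaSeries X) (((Nat.card k : ℚ) ^ r)⁻¹) (Module.finrank K (E.obj X (2 * r))) := by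
  rw [← (E.finrank_algebraicClasses_eq_of_algebraicClasses_eq_top hX h).2]
  exact E.hasPoleOfOrderAt_zetaSeries hE hχ hX hRH hr

end Frobenius

/-! ## §3 Varieties with algebraic even cohomology and no odd cohomology -/

section AlgebraicCohomology

/-- **If every `H^{2r}(X)` is spanned by algebraic classes and every `H^{2r+1}(X)` vanishes, every
`g ∈ Γ_k` acts semisimply on all of `H^*(X)`** (scalars in even degrees, nothing in odd degrees).
[cite: Kahn2020, §6.14 SS^i(X, l)] [cite: Tate1994, §1] -/
theorem forall_isSemisimple_ρ_of_algebraic_cohomology (hX : IsSmoothProjective d X)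
    (heven : ∀ r, E.algebraicClasses X r = ⊤) (hodd : ∀ r, Subsingleton (E.obj X (2 * r + 1)))
    (g : Field.absoluteGaloisGroup k) (i : ℕ) : Module.End.IsSemisimple (E.ρ X i g) := by
  obtain ⟨r, rfl | rfl⟩ := Nat.even_or_odd' i
  · exact E.isSemisimple_ρ_of_algebraicClasses_eq_top hX (heven r) g
  · haveI := hodd r
    exact isSemisimple_of_subsingleton _

/-- `T^r(X)` for every `r` when all even cohomology is algebraic.
[cite: Milne2007TateFiniteFieldsAIM, §1 Conjecture T^r(X, ℓ)] -/
theorem forall_tateConjectureFor_of_algebraic_cohomology (hX : IsSmoothProjective d X)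
    (heven : ∀ r, E.algebraicClasses X r = ⊤) (r : ℕ) : E.TateConjectureFor X r :=
  E.tateConjectureFor_of_algebraicClasses_eq_top hX (heven r)

variable [Finite k]

/-- Finite field, algebraic even cohomology and no odd cohomology: **Frobenius is semisimple on all
of `H^*(X)` and of `H^*(X × X)`, `S` holds for every twisted Frobenius there, and the strong Tate
condition `S^d(X × X)` of Th. 6.54 holds.** [cite: Kahn2020, §6.14 Th. 6.54]
[cite: Milne2007TateFiniteFieldsAIM, §1 Conjecture S^r(X, ℓ) and Th. 1.3] -/
theorem semisimple_and_strongTate_of_algebraic_cohomology (hX : IsSmoothProjective d X)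
    (heven : ∀ r, E.algebraicClasses X r = ⊤) (hodd : ∀ r, Subsingleton (E.obj X (2 * r + 1)))
    (e : ℕ) (j : ℤ) :
    Module.End.IsSemisimple (E.frobAction X e) ∧
      Module.End.IsSemisimple (E.frobAction (X ⊗ X) e) ∧
      LinearMap.ker (E.ρTwist X e j (geomFrob k) - 1) ⊓
          LinearMap.range (E.ρTwist X e j (geomFrob k) - 1) = ⊥ ∧
      LinearMap.ker (E.ρTwist (X ⊗ X) e j (geomFrob k) - 1) ⊓
          LinearMap.range (E.ρTwist (X ⊗ X) e j (geomFrob k) - 1) = ⊥ ∧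
      LinearMap.ker (E.ρTwist (X ⊗ X) (2 * d) d (geomFrob k) - 1) ⊓
          LinearMap.range (E.ρTwist (X ⊗ X) (2 * d) d (geomFrob k) - 1) = ⊥ := by
  have h : ∀ i, Module.End.IsSemisimple (E.frobAction X i) :=
    E.forall_isSemisimple_ρ_of_algebraic_cohomology hX heven hodd (geomFrob k)
  exact ⟨h e, E.isSemisimple_frobAction_tensor_of_forall hX hX h h e,
    E.ker_inf_range_eq_bot_twist_of_isSemisimple_frobAction X e j (h e),
    E.ker_inf_range_eq_bot_tensor_of_isSemisimple_frobAction hX hX h h e j,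
    E.ker_inf_range_eq_bot_self_product_of_isSemisimple_frobAction hX h⟩

/-- Finite field, all even cohomology algebraic: Tate's (a) `T^r ∧ E^r` in every codimension
`r ≤ d`. [cite: Tate1994, §2 Th. 2.9] [cite: Milne2007TateFiniteFieldsAIM, §1 Conjectures T^r, E^r] -/
theorem forall_tate_a_of_algebraic_cohomology (hX : IsSmoothProjective d X)
    (heven : ∀ r, E.algebraicClasses X r = ⊤) {r s : ℕ} (h2 : 2 * r + 2 * s = 2 * d) :
    E.algebraicClasses X r = LinearMap.ker (E.ρTwist X (2 * r) r (geomFrob k) - 1) ∧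
      ∀ x ∈ E.ratAlgebraicClasses X r, (∀ y ∈ E.ratAlgebraicClasses X s,
        E.cupPairing X d (2 * r) (2 * s) h2 x y = 0) → x = 0 :=
  E.tate_a_of_algebraicClasses_eq_top hX h2 (heven r) (heven s)

end AlgebraicCohomology

end GaloisWeilCohomology

end Literature.AlgebraicGeometry.Motives

end
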